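import Mathlib
import Literature.NumberTheory.LFunctions.Zhang2022.TypedSection15A
import Literature.NumberTheory.LFunctions.Zhang2022.TypedSection15AIdentities
import Literature.NumberTheory.LFunctions.Zhang2022.Section15Bcoef
import HarnessLib

/-!
# Zhang (2022) §15 part A — the un-displayed SUB-STEPS of (15.4)/(15.5), typed as helper claims
# (pp. 80–81, tex L4033–L4081), with the exact bookkeeping edges kernel-checked

Topic `Literature/NumberTheory/LFunctions/Zhang2022` (Landau–Siegel audit tree; verdict-neutral).
Y. Zhang, *Discrete mean estimates and the Landau–Siegel zero*, arXiv:2211.02515v1 (2022)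
[Zhang2022LandauSiegel] — **an unrefereed manuscript under adjudication. Every `def … : Prop` below
is a CLAIM OF THE MANUSCRIPT (a sentence of its text between two displays), STATED NOT ASSERTED;
nothing here asserts or denies its Theorems 1–2.** Lane ZHANG-L (discharge of the typed §15 leaves),
work package WP15, typer file: the slice `Typed.Section15A` (`TypedSection15A.lean`) typed every
DISPLAY and every numbered step `§15.u0xx` of pp. 79–83; three of those steps are printed as ONE
sentence doing TWO things, and the discharge lane needs the two halves as separate kernel targets so
that independent provers can take them:

| printed sentence (tex line) | typed node (owner `Typed.Section15A`) | halves typed HERE |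
|---|---|---|
| L4081 "Hence, moving the segment `𝔍(α)` to `𝔍(1)` with a negligible error, we obtain (15.5)" | `Eq15_5 c′ b` | `Eq15_5a` (the move, `O(ε)`) · `Eq15_5b` (the identification of the `𝔍(1)`-integral with `Θ₂(0,𝐤₁*,𝐚₁*)` — an EXACT identity, PROVED here at the χ-reading `bChi`: `eq15_5b_chi_holds`) · EDGE `eq15_5_of_parts`, `eq15_5_chi_of_move` |
| L4033 "Hence, moving the segment `𝔍(−α)` to `𝔍(−1)` with a negligible error, we find that [u008]" | `Step15_u008 c′` | `Step15_u008a` (the move, `O(ε)`) · `Step15_u008b` (the pointwise rewriting of `𝔨₁(s,ψ)` on `𝔍(−1)` through u004–u007 and (15.1)) · exact lemma `ktildeSeries_eq_twist` |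
| L4037 "the sum over `ψ ∈ Ψ₁` can be extended to the sum over `ψ ∈ Ψ`, and then the segment `𝔍(−1)` can be replaced by the line `σ = −1/2`, with acceptable errors" | `Step15_u009 c′` | `Step15_u009a` (extension `Ψ₁ → Ψ`, `o(𝔓)`) · `Step15_u009b` (segment → line, `o(𝔓)`) · EDGE `step15_u009_of_parts` |
| L4045/L4052 u011 "for `n < PT⁻⁵` …" used in u012 for every `n` in the support of `b` (`n < PT⁻²η₊`, (15.2)) | `Step15_u011` (PROVED on the printed range) | `Step15_u011w` — the same orthogonality bound on the range the consumer needs (`n, Dm < p`), PROVED (`step15_u011w_holds`) · `Step15_u012a` — the exact double-sum identity behind "it follows that" (interchange + u010) |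

Typing notes (not verdicts). (i) The relative error `(1 + O(𝓛⁻¹²³))` of `Step15_u008b` cannot be
turned into the `o(𝔓)` of `Step15_u008` by size bounds alone (on `σ = −1/2`, `|B(s,ψ)| ≲ (P/T²)^{3/2}`,
so `Σ_ψ∫|M ω|` exceeds `𝔓` by a power of `P`); the manuscript's "we find that" presupposes that the
error factor is carried through the localisation argument u010–u012 (it depends on `ψ` only through
`p` and the parity of `ψ`). (ii) `Step15_u011` is typed and proved on the printed range `n < PT⁻⁵`;
u012 sums `n` over the support of `b`, `n < PT⁻²η₊` (`Skeleton.bcoef_eq_zero_of_le`); the proof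
(`PrimChar` orthogonality) only uses `n, Dm < p`, which is what `Step15_u011w` states.
Conventions as in `TypedSection15A` (`ForAllLarge`, (A) as antecedent, `O(ε)` ↦ `C·exp(−c𝓛¹⁰)`,
`o(𝔓)` ↦ `∀ ε > 0, eventually ≤ ε𝔓`, segments `𝔍(z)` = `Lemma81.segInt (t0 D) (ell1 D) z`,
`Σ*_{ψ mod p}` = `sumPrim`). No instances, no notation; nothing banked is restated.

## References
* Y. Zhang, arXiv:2211.02515v1 (2022), §15 pp. 80–81 (tex L4033–L4081), (15.4), (15.5); §14 p. 76
  (`Θ₂`); §8 p. 43 (the model moves `𝔍(α) → 𝔍(1)`, §8.u016). [cite: Zhang2022LandauSiegel, §15 pp. 80–81]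
-/

noncomputable section

open Complex Real ComplexConjugate

namespace Literature.NumberTheory.LFunctions.Zhang2022.Typed.Section15A

open Literature.NumberTheory.LFunctions.Zhang2022.Skeleton

/-! ## (15.5) = segment move + exact identification -/

/-- **(15.5), first half** (§15 p. 81, tex L4081: "moving the segment `𝔍(α)` to `𝔍(1)` with a
negligible error"): `Σ_{ψ∈Ψ₁} I₂⁺(ψ) = Σ_{ψ∈Ψ₁} (1/2πi)∫_{𝔍(1)} 𝔨₁(s,ψ)ω(s)ds + O(ε)` (under (A): no zero
of `L(s,ψ)` between the segments by Prop. 2.2 (i); horizontal edges negligible because `ω` is; the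
§8.u016 pattern `Section8a.Step8u016`). CLAIM. [cite: Zhang2022LandauSiegel, §15 (15.5) p. 81] -/
def Eq15_5a (c' : ℝ) : Prop :=
  ∃ c : ℝ, 0 < c ∧ ∃ C : ℝ, ForAllLarge fun D _ χ => AssumptionA D χ →
    ‖(∑ x ∈ finsetOf (PsiOne χ), I2pm c' χ x (alpha D)) -
        ∑ x ∈ finsetOf (PsiOne χ), I2pm c' χ x 1‖ ≤ C * Real.exp (-c * ell D ^ 10)

/-- **(15.5), second half** (§15 p. 81, tex L4081 with u013–u017): on `𝔍(1)` (`σ = 3/2`) the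
integrand `𝔨₁(s,ψ)ω(s)` IS the integrand of `Θ₂(0,𝐤₁*,𝐚₁*)` (§14 p. 76): `Σ_{ψ∈Ψ₁} (1/2πi)∫_{𝔍(1)}
𝔨₁(s,ψ)ω(s)ds = Θ₂(0,𝐤₁*,𝐚₁*)` with `κ₁* = κ₁∗b`, `a₁* = g̃₃`, for a coefficient family `b`
(printed node `b = bLit`; an EXACT identity at the χ-reading `b = bChi`, `eq15_5b_chi_holds`).
CLAIM. [cite: Zhang2022LandauSiegel, §15 (15.5) p. 81] -/
def Eq15_5b (c' : ℝ) (b : CoefFam) : Prop :=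
  ∀ (D : ℕ) [NeZero D] (χ : DirichletCharacter ℂ D),
    ∑ x ∈ finsetOf (PsiOne χ), I2pm c' χ x 1 =
      Theta2 χ 0 (kappaStar1 c' D (b D χ)) (aStar1 c' D)

/-! ## u008 = segment move + pointwise rewriting on `𝔍(−1)` -/

/-- **§15.u008, first half** (§15 p. 80, tex L4033: "moving the segment `𝔍(−α)` to `𝔍(−1)` with a
negligible error"): `Σ_{ψ∈Ψ₁} I₂⁻(ψ) = Σ_{ψ∈Ψ₁}(1/2πi)∫_{𝔍(−1)}𝔨₁(s,ψ)ω(s)ds + O(ε)` (under (A); no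
zero of `L(s,ψ)`, `ψ ∈ Ψ₁`, with `−1/2 ≤ σ ≤ 1/2 − α`, `|t − 2πt₀| ≤ 𝓛₁` by Prop. 2.2 (i); horizontal
edges negligible). CLAIM. [cite: Zhang2022LandauSiegel, §15 p. 80] -/
def Step15_u008a (c' : ℝ) : Prop :=
  ∃ c : ℝ, 0 < c ∧ ∃ C : ℝ, ForAllLarge fun D _ χ => AssumptionA D χ →
    ‖(∑ x ∈ finsetOf (PsiOne χ), I2pm c' χ x (-alpha D)) -
        ∑ x ∈ finsetOf (PsiOne χ), I2pm c' χ x (-1)‖ ≤ C * Real.exp (-c * ell D ^ 10)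

section UEightB

variable (c' : ℝ) {D : ℕ} [NeZero D] (χ : DirichletCharacter ℂ D) (x : Chr D)

/-- The main factor of u008 on `𝔍(−1)`: `τ(χ)χ(p)(pt₀)^{−β₃}·(Σ_m k̃(m)ψ̄(Dm)(Dm)^{s−1})·B(s,ψ)`
(plumbing abbreviation for the right side of u008 before integration).
[cite: Zhang2022LandauSiegel, §15 p. 80] -/
def mainU008 (s : ℂ) : ℂ :=
  GammaFactor.tau χ * χ (x.p : ZMod D) * (((x.p : ℝ) * t0 D : ℝ) : ℂ) ^ (-beta3 c' D) *
    (ktildeSeries c' x s * Bpoly χ x s)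

end UEightB

/-- **§15.u008, second half** (§15 p. 80, tex L4017–L4033, the composition of u004 (functional
equation (2.2) + Lemma 5.1), u005, u006 and u007 that the word "Hence" performs): for `s ∈ 𝔍(−1)`,
`𝔨₁(s,ψ) = τ(χ)χ(p)(pt₀)^{−β₃}(Σ_m k̃(m)ψ̄(Dm)(Dm)^{s−1})B(s,ψ)·(1 + O(𝓛⁻¹²³))` (the `O(e^{−πt})` of
u006 is absorbed: `t ≥ 2πt₀ − 𝓛₁`). Typed as `‖𝔨₁ − M‖ ≤ C𝓛⁻¹²³‖M‖`, for every `ψ ∈ Ψ` (the printed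
derivation assumes `ψ ∈ Ψ₁` only to place `s`; the identities do not use it). NOT a display of the
manuscript — an intermediate claim of its text. CLAIM. [cite: Zhang2022LandauSiegel, §15 p. 80] -/
def Step15_u008b (c' : ℝ) : Prop :=
  ∃ C : ℝ, ForAllLarge fun D _ χ => ∀ x : Chr D, ∀ s : ℂ, MemJ D (-1) s →
    ‖frakk1 c' χ x s - mainU008 c' χ x s‖ ≤ C * (ell D ^ 123)⁻¹ * ‖mainU008 c' χ x s‖

/-! ## u009 = extension `Ψ₁ → Ψ` + segment `𝔍(−1)` → line `σ = −1/2` -/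

section UNine

variable (c' : ℝ) {D : ℕ} [NeZero D] (χ : DirichletCharacter ℂ D) (x : Chr D)

/-- The `ψ`-summand of the right side of u008: `χ(p)(pt₀)^{−β₃}·(1/2πi)∫_{𝔍(−1)}(Σ_m k̃(m)ψ̄(Dm)
(Dm)^{s−1})B(s,ψ)ω(s)ds` (plumbing abbreviation). [cite: Zhang2022LandauSiegel, §15 p. 80] -/
def termSegU009 : ℂ :=
  χ (x.p : ZMod D) * (((x.p : ℝ) * t0 D : ℝ) : ℂ) ^ (-beta3 c' D) *
    Lemma81.segInt (t0 D) (ell1 D) (-1) (fun s =>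
      ktildeSeries c' x s * Bpoly χ x s * omegaW D s)

/-- The `ψ`-summand of the right side of u009: the same with the segment `𝔍(−1)` replaced by the
whole line `σ = −1/2`, `(1/2π)∫_ℝ F(−1/2 + it)dt` (plumbing abbreviation).
[cite: Zhang2022LandauSiegel, §15 p. 80] -/
def termLineU009 : ℂ :=
  χ (x.p : ZMod D) * (((x.p : ℝ) * t0 D : ℝ) : ℂ) ^ (-beta3 c' D) *
    ((1 / (2 * π) : ℂ) * ∫ t : ℝ, ktildeSeries c' x (-1 / 2 + t * I) *
      Bpoly χ x (-1 / 2 + t * I) * omegaW D (-1 / 2 + t * I))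

end UNine

/-- **§15.u009, first half** (§15 p. 80, tex L4037: "In a way similar to the proof of (7.3), the sum
over `ψ ∈ Ψ₁` can be extended to the sum over `ψ ∈ Ψ` … with acceptable errors"):
`τ(χ)Σ_{ψ∈Ψ₁}[…𝔍(−1)…] = τ(χ)Σ_{ψ∈Ψ}[…𝔍(−1)…] + o(𝔓)`. CLAIM. [cite: Zhang2022LandauSiegel, §15 p. 80] -/
def Step15_u009a (c' : ℝ) : Prop :=
  ∀ ε : ℝ, 0 < ε → ForAllLarge fun D _ χ => AssumptionA D χ →
    ‖GammaFactor.tau χ * (∑ x ∈ finsetOf (PsiOne χ), termSegU009 c' χ x) -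
        GammaFactor.tau χ * ∑ᶠ x : Chr D, termSegU009 c' χ x‖ ≤ ε * frakP D

/-- **§15.u009, second half** (§15 p. 80, tex L4037: "… and then the segment `𝔍(−1)` can be replaced
by the line `σ = −1/2`, with acceptable errors"): `τ(χ)Σ_{ψ∈Ψ}[…𝔍(−1)…] = τ(χ)Σ_{ψ∈Ψ}[…σ = −1/2…] +
o(𝔓)` (the tails `|t − 2πt₀| > 𝓛₁` of `ω`). CLAIM. [cite: Zhang2022LandauSiegel, §15 p. 80] -/
def Step15_u009b (c' : ℝ) : Prop :=
  ∀ ε : ℝ, 0 < ε → ForAllLarge fun D _ χ => AssumptionA D χ →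
    ‖GammaFactor.tau χ * (∑ᶠ x : Chr D, termSegU009 c' χ x) -
        GammaFactor.tau χ * ∑ᶠ x : Chr D, termLineU009 c' χ x‖ ≤ ε * frakP D

/-! ## u011 on the range the consumer needs -/

/-- **§15.u011, consumer's range** (§15 p. 81, tex L4045; NOT the printed range): for `p ∼ P` and
`n, Dm < p` (in particular for every `n` in the support of `b`, `n < PT⁻²η₊ < P < p`, and `Dm < 2n`),
"`Σ*_{ψ (mod p)} ψ(n)ψ̄(Dm) ≪ p` if `n = Dm`, `≪ 1` if `n ≠ Dm`". The printed u011 (`Step15_u011`,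
`n < PT⁻⁵`) is the special case; the orthogonality proof is the same (`step15_u011w_holds`, `C = 1`).
CLAIM-VARIANT for the discharge lane. [cite: Zhang2022LandauSiegel, §15 p. 81] -/
def Step15_u011w : Prop :=
  ∃ C : ℝ, ForAllLarge fun D _ _ => ∀ p ∈ primeWindow D, ∀ n m : ℕ, n < p → D * m < p →
    ‖sumPrim fun (ψ : DirichletCharacter ℂ p) _ =>
        ψ (n : ZMod p) * conj (ψ ((D * m : ℕ) : ZMod p))‖ ≤ if n = D * m then C * p else C

/-! ## u012: the exact double-sum identity behind "it follows that" -/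

section UTwelve

variable (c' : ℝ) {D : ℕ} [NeZero D] (χ : DirichletCharacter ℂ D)

/-- The Gaussian localisation factor of u010: `(Dm)⁻¹(Dm/n)^{s₀}exp{−𝓛₂²log²(Dm/n)}` (the right side
of `Step15_u010`). [cite: Zhang2022LandauSiegel, §15 p. 81] -/
def gaussU010 (D n m : ℕ) : ℂ :=
  ((D * m : ℕ) : ℂ)⁻¹ * ((((D * m : ℕ) : ℝ) / n : ℝ) : ℂ) ^ s0 D *
    (Real.exp (-(ell2 D ^ 2 * Real.log (((D * m : ℕ) : ℝ) / n) ^ 2)) : ℂ)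

end UTwelve

/-- **§15.u012, the identity behind "it follows that"** (§15 p. 81, tex L4041–L4052): for `p ∼ P`,
expanding `B(s,ψ) = Σ_n (χb)(n)ψ(n)n^{−s}` ((15.1), a finite sum: `n < PT⁻²`) and `Σ_m k̃(m)ψ̄(Dm)
(Dm)^{s−1}`, interchanging the `ψ`-sum, the two `n, m`-sums and the `t`-integral (absolute
convergence on `σ = −1/2`: `k̃ ≪ τ₄`, `(Dm)^{−3/2}`), and evaluating the inner integral by u010
(`step15_u010_holds`): `Σ*_{ψ(mod p)}(1/2πi)∫_{(−1/2)}(Σ_m k̃(m)ψ̄(Dm)(Dm)^{s−1})B(s,ψ)ω(s)ds =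
Σ_n Σ_m (χb)(n)k̃(m)·[Σ*_{ψ}ψ(n)ψ̄(Dm)]·(Dm)⁻¹(Dm/n)^{s₀}exp{−𝓛₂²log²(Dm/n)}` (`n` over
`0 ≤ n < ⌈PT⁻²⌉`, the `n = 0`, `m = 0` terms vanish). An EXACT identity of the manuscript's objects
(the step before the bound `≪ PD^{−4/5}`); not displayed in print. CLAIM.
[cite: Zhang2022LandauSiegel, §15 p. 81] -/
def Step15_u012a (c' : ℝ) : Prop :=
  ForAllLarge fun D _ χ => ∀ (p : ℕ) (hp : p ∈ primeWindow D),
    (sumPrim fun (ψ : DirichletCharacter ℂ p) hψ =>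
        (1 / (2 * π) : ℂ) * ∫ t : ℝ,
          ktildeSeries c' (⟨p, hp, ψ, hψ⟩ : Chr D) (-1 / 2 + t * I) *
            Bpoly χ ⟨p, hp, ψ, hψ⟩ (-1 / 2 + t * I) * omegaW D (-1 / 2 + t * I)) =
      ∑ n ∈ Finset.range ⌈bigP D / bigT D ^ 2⌉₊, ∑' m : ℕ,
        bchi χ n * ktilde c' D m *
          (sumPrim fun (ψ : DirichletCharacter ℂ p) _ =>
              ψ (n : ZMod p) * conj (ψ ((D * m : ℕ) : ZMod p))) *
          gaussU010 D n m

/-! ## RT15-int-1 (WP15-PLAN v0.2a): the u008 route of record (α) → (β) → (γ) → u007 → u008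

The split `Step15_u008a`/`Step15_u008b` above takes the relative errors of u004/u006 on `𝔍(−1)`, where
they are not absorbable (typing note (i) of the module docstring; zl-closer-1's seam 23:57Z; T2 report
wp09/zl-w09-ref-2/T2-TypedSection15ASubsteps.md F1); the manuscript takes them on `𝔍(−α)` ("Assume
`ψ ∈ Ψ₁` and `s ∈ 𝔍(−α)`", tex L4017) and disposes of them there ("In a way similar to the proof of
Lemma 8.1 … the total contribution of the `O(𝓛⁻¹²³)` term to the left side of (15.4) is `o(𝔓)`",
tex L4020), THEN moves the main term. The nodes below type that order of operations (signatures =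
zl-closer-1's `strike/zl-closer-1/U008-SIGNATURES.lean`, 2026-08-27T00:22Z, `M₁` in the term order of
zl-w15-p6's landed `Section15U008Alpha.step15_u008alpha_holds`, so that theorem IS `Step15_u008alpha`
by unfolding `mainU008alpha`); the assembly `step15_u008_of : (α) → (β) → (γ) → Step15_u007 →
Step15_u008` is zl-closer-1's. -/

section UEightRoute

variable (c' : ℝ) {D : ℕ} [NeZero D] (χ : DirichletCharacter ℂ D) (x : Chr D)

/-- **`M₁(s,ψ)`**, the main term of `𝔨₁(s,ψ)` on `𝔍(−α)` after u004–u006 (§15 p. 80, tex L4017–L4029):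
`τ(χ)χ(p)ψ̄(D)(pt₀)^{−β₃}D^{s−1}·L(1−s−β₁,ψ̄)L(1−s−β₂,ψ̄)/L(1−s,ψ̄)·B(s,ψ)K(1−s−β₃,ψ̄)` (plumbing
abbreviation; term order = `Section15U008Alpha.step15_u008alpha_holds`).
[cite: Zhang2022LandauSiegel, §15 p. 80] -/
def mainU008alpha (s : ℂ) : ℂ :=
  GammaFactor.tau χ * χ (x.p : ZMod D) * conj (x.ψ (D : ZMod x.p)) *
    (((x.p : ℝ) * t0 D : ℝ) : ℂ) ^ (-beta3 c' D) * (D : ℂ) ^ (s - 1) *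
    (x.ψ⁻¹.LFunction (1 - s - beta1 c' D) * x.ψ⁻¹.LFunction (1 - s - beta2 c' D) /
      x.ψ⁻¹.LFunction (1 - s)) *
    Bpoly χ x s * Kchar D (psiBarFn x) (1 - s - beta3 c' D)

end UEightRoute

/-- **u008 (α)** (§15 p. 80, tex L4017–L4029: u004 ∘ u005 ∘ u006, pointwise on `𝔍(−α)`):
`𝔨₁(s,ψ) = M₁(s,ψ)(1 + O(𝓛⁻¹²³))` for `ψ ∈ Ψ₁`, `s ∈ 𝔍(−α)`, typed `‖𝔨₁ − M₁‖ ≤ C𝓛⁻¹²³‖M₁‖`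
(the `O(e^{−πt})` of u006 absorbed). A THEOREM of the tree as an inline statement:
`Section15U008Alpha.step15_u008alpha_holds` (zl-w15-p6) — this node names it. CLAIM.
[cite: Zhang2022LandauSiegel, §15 p. 80] -/
def Step15_u008alpha (c' : ℝ) : Prop :=
  ∃ C : ℝ, ForAllLarge fun D _ χ => ∀ x ∈ PsiOne χ, ∀ s : ℂ, MemJ D (-alpha D) s →
    ‖frakk1 c' χ x s - mainU008alpha c' χ x s‖ ≤ C * (ell D ^ 123)⁻¹ * ‖mainU008alpha c' χ x s‖

/-- **u008 (β)** (§15 p. 80, tex L4020: "In a way similar to the proof of Lemma 8.1, it can be shown …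
that the total contribution of the `O(𝓛⁻¹²³)` term to the left side of (15.4) is `o(𝔓)`") — typed as
the MEAN VALUE that makes it so: on `𝔍(−α)`, in the parametrisation `s = −α + s₀ + iv`, `|v| ≤ 𝓛₁`, of
`Lemma81.segInt`, `Σ_{ψ∈Ψ₁}∫‖M₁(s,ψ)ω(s)‖dv ≤ C·𝔓·𝓛¹²²` (so `𝓛⁻¹²³ × (β) = O(𝔓/𝓛) = o(𝔓)`; any bound
`P²𝓛^k`, `k < 46`, implies it via `P² ≤ 2𝔓𝓛⁷⁷`). Signature = zl-closer-1's. CLAIM.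
[cite: Zhang2022LandauSiegel, §15 p. 80] -/
def Step15_u008beta (c' : ℝ) : Prop :=
  ∃ C : ℝ, ForAllLarge fun D _ χ => AssumptionA D χ →
    (∑ x ∈ finsetOf (PsiOne χ), ∫ v in (-ell1 D)..ell1 D,
        ‖mainU008alpha c' χ x (((-alpha D : ℝ) : ℂ) + s0 D + v * I) *
          omegaW D (((-alpha D : ℝ) : ℂ) + s0 D + v * I)‖) ≤ C * frakP D * ell D ^ 122

/-- **u008 (γ)** (§15 p. 80, tex L4033: "Hence, moving the segment `𝔍(−α)` to `𝔍(−1)` with a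
negligible error" — applied, as printed, to the MAIN TERM `M₁ω` after (α)/(β)):
`Σ_{ψ∈Ψ₁}(1/2πi)∫_{𝔍(−α)}M₁ω = Σ_{ψ∈Ψ₁}(1/2πi)∫_{𝔍(−1)}M₁ω + O(ε)` (`M₁` holomorphic on
`−½ ≤ σ ≤ ½−α`, `|t − 2πt₀| ≤ 𝓛₁` by Prop. 2.2 (i) reflected; horizontals by the decay of `ω`). Signature
= zl-closer-1's (the `Step15_u008a` shape with `𝔨₁ ↦ M₁`). CLAIM. [cite: Zhang2022LandauSiegel, §15 p. 80] -/
def Step15_u008gamma (c' : ℝ) : Prop :=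
  ∃ c : ℝ, 0 < c ∧ ∃ C : ℝ, ForAllLarge fun D _ χ => AssumptionA D χ →
    ‖(∑ x ∈ finsetOf (PsiOne χ),
        Lemma81.segInt (t0 D) (ell1 D) ((-alpha D : ℝ) : ℂ)
          (fun s => mainU008alpha c' χ x s * omegaW D s)) -
      ∑ x ∈ finsetOf (PsiOne χ),
        Lemma81.segInt (t0 D) (ell1 D) ((-1 : ℝ) : ℂ)
          (fun s => mainU008alpha c' χ x s * omegaW D s)‖ ≤
      C * Real.exp (-c * ell D ^ 10)

end Literature.NumberTheory.LFunctions.Zhang2022.Typed.Section15A
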